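import Literature.IUT.HodgeArakelov.AbsTopMonoidsNonVacuity

/-!
# [IUTchII] Example 1.8: the inhabitation condition of `AbsTopMonoids` — the clause `Π^tp/Δ ≅ G_k` is
# automatic for an OPEN augmentation

Mochizuki, *Inter-universal Teichmüller theory II*, §1, Example 1.8 (i), kurims manuscript (Dec. 2020) p. 35
[claim: Mochizuki2012, status: disputed] (IUTchII §1 Ex 1.8 (i), kurims p.35): "a topological group `Π`
isomorphic to `Π^tp_{X̲̲_k}`", "the quotient `Π ↠ G` [i.e. `Π/Δ ⥲ G`] … may be characterized group-theoretically".
Record-only vocabulary under the claim key `Mochizuki2012` (D-0012, disputed); abc-iut cell, layer L6,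
proof-only companion (abc-iut-w5-d105, RQ7 audit of p417411) of abc-iut-w5-d114's non-vacuity certificate
`AbsTopMonoidsNonVacuity.lean`, which shows

  `Nonempty (AbsTopMonoids S) ↔ (H1) ∧ (H2)`,
  (H1) = "`Δ := Ker(Π^tp_{X̲̲_k} ↠ G_k)` is carried onto itself by every automorphism of topological groups",
  (H2) = "`Π^tp_{X̲̲_k}/Δ ≅ G_k` as topological groups" (`AbsTopMonoids.nonempty_iff`).

THIS FILE: (H2) is the TOPOLOGICAL FIRST ISOMORPHISM THEOREM for the augmentation `aug : Π^tp_{X̲̲_k} ↠ G_k` of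
the setting (`ThetaSetting.aug`, continuous and surjective; `ThetaSetting.DeltaX := aug.ker`) and holds as soon as
`aug` is an OPEN map (`quotDeltaX_iso_of_isOpenMap`) — in particular whenever `Π^tp_{X̲̲_k}` is compact and `G_k`
Hausdorff (`quotDeltaX_iso_of_compactSpace`). Hence for an open augmentation the interface `AbsTopMonoids S` is
inhabited iff (H1) ALONE (`nonempty_iff_of_isOpenMap`, `nonempty_iff_of_compactSpace`). Elementary topology
(Mathlib `QuotientGroup.quotientKerEquivOfSurjective`, `Equiv.toHomeomorphOfContinuousOpen`,
`Continuous.homeoOfEquivCompactToT2`); no `def`, no named fact, nothing asserted about print; the setting does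
not record openness of `aug`, so it enters as a hypothesis. Nothing here bears on [IUTchIII] Cor. 3.12; no side
is taken.
-/

noncomputable section

namespace Literature.IUT.HodgeArakelov

namespace AbsTopMonoids

universe u

variable (S : ThetaSetting.{u})

/-- The algebraic first isomorphism theorem for the augmentation is continuous: the group isomorphism
`Π^tp_{X̲̲_k}/Δ ⥲ G_k` induced by `aug` (Mathlib `QuotientGroup.quotientKerEquivOfSurjective`) is continuous for
the quotient topology, because `aug` is. [claim: Mochizuki2012, status: disputed] (IUTchII §1 Ex 1.8 (i), kurims p.35) -/
theorem continuous_quotientKerEquiv_aug :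
    Continuous (QuotientGroup.quotientKerEquivOfSurjective S.aug S.aug_surjective) := by
  refine (QuotientGroup.isQuotientMap_mk S.aug.ker).continuous_iff.2 ?_
  have h : (⇑(QuotientGroup.quotientKerEquivOfSurjective S.aug S.aug_surjective) ∘ QuotientGroup.mk) =
      ⇑S.aug := funext fun _ => rfl
  rw [h]
  exact S.aug_continuous

/-- **(H2) from an OPEN augmentation**: if `aug : Π^tp_{X̲̲_k} ↠ G_k` is an open map, then
`Π^tp_{X̲̲_k}/Δ ≅ G_k` as topological groups (the topological first isomorphism theorem: the induced continuous
bijection is open, hence a homeomorphism). [claim: Mochizuki2012, status: disputed] (IUTchII §1 Ex 1.8 (i), kurims p.35) -/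
theorem quotDeltaX_iso_of_isOpenMap (hopen : IsOpenMap S.aug) :
    Nonempty (TopGroup.quot S.PiX S.DeltaX ≃ₜ* S.Gk) := by
  classical
  let e : S.PiX ⧸ S.aug.ker ≃* S.Gk := QuotientGroup.quotientKerEquivOfSurjective S.aug S.aug_surjective
  have he : ∀ x : S.PiX, e (QuotientGroup.mk x) = S.aug x := fun _ => rfl
  have hcont : Continuous e := continuous_quotientKerEquiv_aug S
  have hopen' : IsOpenMap e := by
    intro U hU
    have himg : ⇑e '' U = ⇑S.aug '' ((QuotientGroup.mk : S.PiX → S.PiX ⧸ S.aug.ker) ⁻¹' U) := by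
      ext y
      constructor
      · rintro ⟨q, hq, rfl⟩
        obtain ⟨x, rfl⟩ := QuotientGroup.mk_surjective q
        exact ⟨x, hq, he x⟩
      · rintro ⟨x, hx, rfl⟩
        exact ⟨QuotientGroup.mk x, hx, he x⟩
    rw [himg]
    exact hopen _ (hU.preimage QuotientGroup.continuous_mk)
  let h : (S.PiX ⧸ S.aug.ker) ≃ₜ S.Gk := Equiv.toHomeomorphOfContinuousOpen e.toEquiv hcont hopen'
  have hinv : Continuous e.symm := by
    have hfun : ⇑e.symm = ⇑h.symm := by
      funext y
      apply e.injective
      rw [e.apply_symm_apply]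
      exact (h.apply_symm_apply y).symm
    rw [hfun]
    exact h.symm.continuous
  exact ⟨{ e with continuous_toFun := hcont, continuous_invFun := hinv }⟩

/-- **(H2) in the compact case**: if `Π^tp_{X̲̲_k}` is compact and `G_k` is Hausdorff (e.g. both profinite), then
`Π^tp_{X̲̲_k}/Δ ≅ G_k` as topological groups (a continuous bijection from a compact space onto a Hausdorff space is
a homeomorphism). [claim: Mochizuki2012, status: disputed] (IUTchII §1 Ex 1.8 (i), kurims p.35) -/
theorem quotDeltaX_iso_of_compactSpace [CompactSpace S.PiX] [T2Space S.Gk] :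
    Nonempty (TopGroup.quot S.PiX S.DeltaX ≃ₜ* S.Gk) := by
  classical
  let e : S.PiX ⧸ S.aug.ker ≃* S.Gk := QuotientGroup.quotientKerEquivOfSurjective S.aug S.aug_surjective
  have hcont : Continuous e := continuous_quotientKerEquiv_aug S
  haveI : CompactSpace (S.PiX ⧸ S.aug.ker) := Quotient.compactSpace
  let h : (S.PiX ⧸ S.aug.ker) ≃ₜ S.Gk := Continuous.homeoOfEquivCompactToT2 (f := e.toEquiv) hcont
  have hinv : Continuous e.symm := by
    have hfun : ⇑e.symm = ⇑h.symm := by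
      funext y
      apply e.injective
      rw [e.apply_symm_apply]
      exact (h.apply_symm_apply y).symm
    rw [hfun]
    exact h.symm.continuous
  exact ⟨{ e with continuous_toFun := hcont, continuous_invFun := hinv }⟩

/-- **The inhabitation condition of `AbsTopMonoids S` for an OPEN augmentation is (H1) alone**: the interface of
IUTchII Ex. 1.8 (ii)–(ix) outputs is inhabited iff `Δ ⊆ Π^tp_{X̲̲_k}` is carried onto itself by every automorphism
of topological groups of `Π^tp_{X̲̲_k}` ("the subgroup `Δ ⊆ Π` … may be characterized group-theoretically").
[claim: Mochizuki2012, status: disputed] (IUTchII §1 Ex 1.8 (i), kurims p.35) -/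
theorem nonempty_iff_of_isOpenMap (hopen : IsOpenMap S.aug) :
    Nonempty (AbsTopMonoids S) ↔
      ∀ f : S.PiX ≃ₜ* S.PiX, S.DeltaX.map f.toMulEquiv.toMonoidHom = S.DeltaX := by
  rw [AbsTopMonoids.nonempty_iff]
  exact ⟨fun h => h.1, fun h => ⟨h, quotDeltaX_iso_of_isOpenMap S hopen⟩⟩

/-- The same for compact `Π^tp_{X̲̲_k}` and Hausdorff `G_k`: `AbsTopMonoids S` is inhabited iff (H1).
[claim: Mochizuki2012, status: disputed] (IUTchII §1 Ex 1.8 (i), kurims p.35) -/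
theorem nonempty_iff_of_compactSpace [CompactSpace S.PiX] [T2Space S.Gk] :
    Nonempty (AbsTopMonoids S) ↔
      ∀ f : S.PiX ≃ₜ* S.PiX, S.DeltaX.map f.toMulEquiv.toMonoidHom = S.DeltaX := by
  rw [AbsTopMonoids.nonempty_iff]
  exact ⟨fun h => h.1, fun h => ⟨h, quotDeltaX_iso_of_compactSpace S⟩⟩

end AbsTopMonoids

end Literature.IUT.HodgeArakelov

end
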